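import Literature.MathematicalPhysics.QuantumFieldTheory.Balaban1983to89.B2Eq268HiggsRegion
import Literature.MathematicalPhysics.QuantumFieldTheory.Balaban1983to89.B3Op116LeibnizRows

/-!
# `Balaban1983to89.B2Eq268DerivHiggsRegion` — [Balaban1982Higgs2] Lemma 2.4, proof step **(2.68) «and similarly for the
# derivative»** p. 572 ON THE (Higgs)₂,₃ CARRIER OF RECORD: the two remainder terms of (2.68) UNDER THE COVARIANT DERIVATIVE
# `D^η_{A^{(k)}}` at a bond `b₀ ⊂ □`, bounded on a cell-product box at a (I.2.23)-regular background by the derivative COLUMN sums of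
# the kernels (2.10) — the `V_k`-sources taken in the LEIBNIZ form of (I.3.16) (p35's `B3Op116LeibnizRows`), so that no twice-
# differentiated kernel enters; the Neumann boundary layer of `□` is carried as an explicit sum

statement-level skeleton of published theorems with citation tags; proofs where landed; nothing here is a claim
about the Yang–Mills mass gap

PDF held: `paper:balaban1982-cmp86-higgs23-ii` (journal page = PDF page + 554), p. 572 [PDF 18] ((2.66)–(2.68)), p. 573 [PDF 19]
((2.77)), re-read this session on the ×2 renders `run/shared/lean/pub/pub-balaban/b2b-balaban-ref1/pages/1982-cmp86-higgs23-II/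
1982-cmp86-higgs23-II-p018-x2.png` / `…-p019-x2.png` (text layer `p0018.txt` L11–20); [Balaban1982Higgs1] pp. 614–615 (3.14)–(3.16),
p. 619 (3.44); [Balaban1983Higgs3] p. 426 (2.10) — AS LANDED in the imported files.

CITATION HEADER (lean-in-tree rule).  T. Bałaban, *(Higgs)₂,₃ quantum fields in a finite volume. II. An upper bound*,
Commun. Math. Phys. **86** (1982) 555–594, doi:10.1007/bf01214890 [Balaban1982Higgs2]; inputs of part I, Commun. Math. Phys. **85**
(1982) 603–626 [Balaban1982Higgs1] and part III, Commun. Math. Phys. **88** (1983) 411–445 [Balaban1983Higgs3] AS LANDED in the tree.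
Cell `lit-balaban` (HOME `run/shared/lean/pub/lit-balaban/`), reader/typer seat **r14** gen 21 (B2 second reader; unit
`lit-balaban-r14-g21`; free-target protocol G.5-34(d): the derivative lane D2′/D3′/D4′/D5 of row B2.Lem2.4 — owner r02 WELCOME
2026-08-23T07:13Z, p23 «no priority claimed» 07:20Z; TAKING line HOME/STATUS.md for this stem); SKELETON row **B2.Lem2.4** (Lemma 2.4
(2.65)–(2.66) p. 572; fold owner r02, second reader r14; decl of record `B2.Lemma24Printed`, head `proved p250408 · …` UNCHANGED —
cells-only member; brick D4′ of the located-residue item «the derivative clause (2.66)/(2.77)», after D3′ `B2Eq276DerivHiggsRegion`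
✓ daa73e69fc26 and D2′ `B2Eq274DerivHiggsRegion`).  Cross-references: rows **B1.Eq3.44**, **B1.Eq3.16** / **B3.Eq1.16**, **B3.Eq2.10**,
**B2.Eq2.55**.  USED BY NAME, never restated: p23's F4′ `B2Eq268HiggsRegion.{eq268_identity, bgScalar256_eq_zero_of_not_mem, row_sums_box}`
(the three-term identity, the support of `φ^{(k)}_□`, the derivative column sum `Σ_{y∈□}Σ_i‖(D_BG_k(□,B)e_{(y,i)})(b)‖ ≤ C₂ℓ`), r14's
`B3Op116SourceForm.{srcV, srcMD, srcDM, srcMM, avgSrc, map_srcV, opV_apply_eq_srcV, covDerivAt, norm_mapE_single_le, norm_mapE_srcMD_le,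
norm_mapE_srcMM_le, norm_mapE_avgSrc_le, norm_mapE_le_sum_norm_mul_col}`, p35's `B3Op116LeibnizRows.{pred, nMul, norm_nMul_apply_le',
inv_smul_sum_srcDM_eq}` (THEOREM A′: the `D^{ε*}M` sources in Leibniz form), p40's `B3Op116Pieces.{mulM, fOne, covDeriv_add_split,
norm_mulM_apply_le, norm_fOne_apply_le, fTwoAdj, fTwo, norm_fTwoAdj_apply_le, norm_fTwo_apply_le}` and `B3Ineq210MixedRegularTorus.{dip,
dip_zero}`, the typer's `B2Eq255Concrete.{bgScalar256, cutTo, underRegion}`, p35's `B1Ineq225RegularBox.cellBox`, r14's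
`B1Eq230FluctCov.{Ix, cb}`, `B1Eq353SupNorm.{norm_avgQkLin_apply_le, card_blockK}`, p23's F2 `B2Eq273NeumannLocality.avgQk_blockIter_eq_zero`.

WHAT IS PRINTED (p. 572 [PDF 18]).  *«(D^η_{A^{(k)}}φ^{(k)})(b) = O(p(Lᵏε)) for b ⊂ Bᵏ(Λ₇^{(k−1)′}). (2.66) … φ^{(k)}(x) = (a_kG_k(□,
A^{(k)})Q_k^*(A^{(k)})□₁φ)(x) + O((Lᵏε)^κ), x ∈ Bᵏ(y), (2.67) and the same equality for the covariant derivative of φ^{(k)}. From the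
property (2.60) we have the inequality |A^{(k)}(x) − A^{(k)}(y)| ≤ O(p(Lᵏε)r(Lᵏε)). Let us denote by A₀ a constant configuration equal to
A^{(k)}(y) at each point, thus A^{(k)} − A₀ = O(p(Lᵏε)r(Lᵏε)). Using the expansion formula (I.3.44) and Proposition I.2.2 we have
(a_kG_k(□, A^{(k)})Q_k^*(A^{(k)})□₁φ)(x) = (a_kG_k(□, A₀)Q_k^*(A₀)□₁φ)(x) + (a_kG_k(□, A₀)F_{2,k}(A^{(k)} − A₀, A₀)□₁φ)(x) + (a_kG_k(□, A₀)
V_k(A^{(k)} − A₀, A₀)G_k(□, A^{(k)})Q_k^*(A^{(k)})□₁φ)(x) = (a_kG_k(□, A₀)Q_k^*(A₀)□₁φ)(x) + O((Lᵏε)^{κ₀}), κ₀ > 0, (2.68) and similarly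
for the derivative.»*; p. 571 [PDF 17], Lemma 2.3: *«(∂^η_μA^{(k)})(x) = O(p(Lᵏε)), x ∈ Bᵏ(Λ₂^{(k−1)′}). (2.60)»*; p. 573 [PDF 19]:
*«It was mentioned several times that the corresponding equalities hold for the covariant derivatives of φ^{(k)} and we have
(D^η_{A^{(k)}}φ^{(k)})(b) = U(A₀(Γ_{b₋,y}))(a_k∂^ηG_k(□, 0)Q_k^*□₁φ′)(b) + O((Lᵏε)^{κ₀}), b ⊂ □. (2.77)»*;
[B1] p. 614: *«U(A) = 1 + ηF_{1,k}(A) (3.14)»*, p. 615 (3.16) (`V_k(A′,B)` through `D^*_{A′+B}D_{A′+B} − D^*_BD_B` and the averaging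
terms), p. 619: *«G_k(Ω, A + B) = G_k(Ω, B) + G_k(Ω, B)V_k(A, B)G_k(Ω, A + B) (3.44)»*; [B3] p. 426: *«|G^η_{(j)}(Ω, B̃; x, x′)| ≤
O(1)(Lʲη)^{−d+2}e^{−δ₁(Lʲη)^{−1}|x−x′|}, (2.10) and if the propagator is differentiated, then for each differentiation, there is an
additional factor (Lʲη)^{−1}»*.

THE ARGUMENT (print's «similarly for the derivative», on the carrier; ε-lattice currency `ℓ = Lᵏε`, `κ = a_kℓ⁻²`, `m = |e|sεd(Lᵏ−1)`,
`A = A′ + B`, `w = φ^{(k)}_□ = κG(A)Q^*(A)ψ`, `w₀ = κG(B)Q^*(B)ψ`, `ψ = □₁φ`).  By F4′'s identity `w − w₀ = κG(B)F₂^*ψ + G(B)V_k(A′,B)w` and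
p40's split `D_{A′+B} = D_B + M` ((I.3.14): `M_bf(b₊) = ε⁻¹U(εB_b)(U(εA′_b) − 1)f(b₊)`, `‖M_b‖ ≤ |e||A′_b|`):
`(D_{A′+B}w)(b₀) − (D_Bw₀)(b₀) = M_{b₀}w(b₀₊) + κ(D_BG(B)F₂^*ψ)(b₀) + (D_BG(B)V_kw)(b₀)`.  The first term is `≤ |e|sW₀` (the field switch,
print's `O(|A^{(k)} − A₀|·|φ^{(k)}|)`).  The other two are the value terms of F4′ read through the linear functional
`T′ = (D_B ·)(b₀) ∘ G_k(□,B)` instead of the evaluation at `x`: every source of r14's source form of `V_k` is a charge times a COLUMN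
`κ′(y) = Σ_i‖(D_BG_k(□,B)e_{(y,i)})(b₀)‖` of the ONCE-differentiated kernel — except the `D^{ε*}M` sources, which in the symmetric form
would put the twice-differentiated kernel `D_{b₀}G D^*_b` in the row (whose multiscale sum `Σ_{j<k}O(1)` is not uniform in `k`).  These
are taken instead in p35's LEIBNIZ form (THEOREM A′ `inv_smul_sum_srcDM_eq`, for the field `A″ = A′·1_{b⊂□}`, all of whose sources are the
inside ones): `ε⁻¹Σ_{b⊂□}srcDM_b w = Σ_b δ_{b₋}[N_b w(b₋) − F₁(A″_b)(D_Bw)(b)]`, `‖N_bv‖ ≤ ε⁻¹|e||A″_{b−e_μ} − A″_b|‖v‖`: for `b` and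
`b − e_μ` both inside `□` the difference is `≤ δ_{A′}` (the (I.2.23)-regularity of `A′` on `□`, print's (2.60): `ε⁻¹δ_{A′} = O(p(Lᵏε))`), and
otherwise `b₋` lies in the boundary layer `∂□ = {y ∈ □ : y ± εe_μ ∉ □ for some μ}` where the difference is `≤ s`.  Hence
`‖(D_BG(B)V_kw)(b₀)‖ ≤ [|e|sd(2W₁ + |e|sW₀) + ε⁻¹|e|δ_{A′}dW₀ + |κ|(2m + m²)W₀]·Σ_{y∈□}κ′(y) + ε⁻¹|e|sdW₀·Σ_{y∈∂□}κ′(y)` and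
`‖κ(D_BG(B)F₂^*ψ)(b₀)‖ ≤ κmt′·Σ_{y∈□}κ′(y)`; F4′'s `row_sums_box` (p35's (2.10) on boxes, derivative clause, summed over the lattice and the
scales: `Σ_{j<k}Lʲε ≤ ℓ`) gives `Σ_{y∈□}κ′(y) ≤ C₂ℓ` at every bond `b₀ ⊂ □` — print's «Proposition I.2.2 … additional factor (Lʲη)^{−1}».
The boundary-layer column `Σ_{y∈∂□}κ′(y)` is left explicit here (its `ε⁻¹` is compensated by the codimension of `∂□` and the distance
`≥ R` from `b₀` to `∂□` through the decay of (2.10) — the assembly's business, with print's «x ∈ Bᵏ(y)», `dist(Bᵏ(y), □ᶜ) ≈ 4r(Lᵏε)`).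

WHAT THIS FILE PROVES (kernel-checked, zero `sorry`; theorems only — NO definition, NO `Prop`-valued fact; axioms standard).
 §1 `fOne_zero`, `mulM_congr`, `mulM_apply_eq_zero`, `srcDM_congr`, `srcDM_eq_zero` (the multiplier and the `D^{ε*}M` source depend on
    `A′` only through `A′_b` and vanish where `A′_b = 0`), **`norm_covDeriv_add_sub_le`** (the field switch `‖(D_{A′+B}f)(b) − (D_Bf)(b)‖ ≤
    |e|s‖f(b₊)‖`).
 §2 bookkeeping (private): bond sums read at sources/targets against block-supported weights.
 §3 **`norm_T1_deriv_le`** (the `F₂` term under `D_B` by the derivative column), **`norm_leibniz_bond_le`** / **`norm_sum_srcDM_map_le`**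
    (the `D^{ε*}M` sources through ANY linear `T` in Leibniz form: interior `ε⁻¹|e|δ_{A′}`, boundary layer `ε⁻¹|e|s`, and `|e|sW₁`),
    **`norm_T2_deriv_le`** (the `V_k` term under `D_B`).
 §4 **`eq268_deriv_box`**: for `Bᵏ(□₂)` a cell-product box, `□₁ ⊆ □₂`, `b₀ ⊂ Bᵏ(□₂)`:
    `‖(D_{A′+B}φ^{(k)}_□[A′+B])(b₀) − (D_Bφ^{(k)}_□[B])(b₀)‖ ≤ |e|sW₀ + C₂ℓ·[κmt′ + |e|sd(2W₁ + |e|sW₀) + ε⁻¹|e|δ_{A′}dW₀ + κ(2m + m²)W₀]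
     + ε⁻¹|e|sdW₀·Σ_{y∈∂□}Σ_i‖(D_BG_k(□,B)e_{(y,i)})(b₀)‖` — F4′'s `eq268_box` word for word except: `x ∈ □ ↦ b₀ ⊂ □` (a bond inside),
    `+ {δA}, 0 ≤ δA, regularity of A′ along the collinear pairs of bonds inside □`, values ↦ covariant derivatives on the left, and the
    right side as displayed.  v1.1: the δ_{A′} hypothesis is asked ONLY for collinear pairs of bonds both inside `□` (the pairs the Leibniz
    charge `N_b` sees) — weakened from v1.0 (p358964, all pairs `z ∈ □`, `μ`, `ν`) so that the assembly's cut field `(A − A₀)·1_{b⊂□}`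
    qualifies; nothing else changed.

HONEST SCOPE / DIFFERENCES FROM PRINT (recorded, not hidden).  (a) as F4′ (a)–(b): `□ = Bᵏ(□₂)` a cell-product box of big blocks with
p35's torus-room hypotheses; `B` any (I.2.23)-regular field with `Lᵏδ_B|e| ≤ t` (print: the constant `A₀`); `|A′_b| ≤ s` on all bonds.
(b) NEW HYPOTHESIS relative to the value clause: the regularity `|A′_{⟨z+εe_μ,μ⟩} − A′_{⟨z,μ⟩}| ≤ δ_{A′}` along the collinear pairs of bonds
inside `□` (v1.1; v1.0 asked the (I.2.23)-shape for all `z ∈ □`, `μ`, `ν`) — print's (2.60) for `A^{(k)}` («(∂^η_μA^{(k)})(x) = O(p(Lᵏε))»;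
`A₀` constant), entering as `ε⁻¹|e|δ_{A′}`.  (b′) The LEADING term `|e|sW₀`
(coefficient 1, NO factor `Lᵏε`) is the field switch `D_{A′+B} → D_B` at `b₀` (`norm_covDeriv_add_sub_le`); it is small only through the
READING of `s` (`s = |A^{(k)} − A₀| = O(p(Lᵏε)r(Lᵏε))` on `□` by (2.60), the assembly's (β).s) — print's «similarly» hides exactly this term.
(b″) The row prefactor is `C₂·Lᵏε` (the derivative column of F4′'s `row_sums_box`, clause 3), one power of `Lᵏε` less than F4′'s `C₁·(Lᵏε)²`
value row — the power spent on the `D_{b₀}G_k` row, as print's «additional factor (Lʲη)^{−1}»; `C₁` is not used by the bound and is kept in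
the quantifier prefix only to stay word for word with F4′'s `eq268_box`.  (c) THE BOUNDARY LAYER TERM
`ε⁻¹|e|sdW₀·Σ_{y∈∂□}Σ_i‖(D_BG_k(□,B)e_{(y,i)})(b₀)‖` is NOT bounded here: it is the price of the Neumann boundary condition of `G_k(□,·)` in
the Leibniz form (the divergence of `A″ = A′1_□` across `∂□`), small only for `b₀` far from `∂□` (print's `b ⊂ Bᵏ(y)`, `□ ⊃` the blocks within
`4r(Lᵏε)` of `y`) by the decay of (2.10) — deferred to the assembly brick (D5) together with the sizes `s, W₀, W₁, t′, δ_{A′}` from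
(2.55)/(2.60) and the conclusion `O((Lᵏε)^{κ₀})·(Lᵏε)⁻¹`; print does not display this bookkeeping («similarly»).  (d) The main term
`(D_{A₀}(a_kG_k(□, A₀)Q_k^*(A₀)□₁φ))(b₀)` is D2′/D3′'s; (2.67)-for-the-derivative is p23's `B2Eq267HiggsRegion.eq267_deriv_higgs_region`; nothing
of (2.66) is assembled here.  Value = print's «similarly for the derivative» of (2.68) now holds, with explicit remainder and an explicit
boundary-layer column, for the carrier of record's own `G^ε_k(□,·)`, `D^ε` and `φ^{(k)}`; NOT summit progress.
-/

open scoped BigOperators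

noncomputable section

namespace Literature.MathematicalPhysics.QuantumFieldTheory.Balaban1983to89.B2Eq268DerivHiggsRegion

open HiggsLattice (ChargeData covDeriv)
open HiggsAveraging (blockIter blockK mem_blockK)
open HiggsCovariance (propagatorK avgQkLin avgQkAdj E)
open HiggsCovariancePos (Inside shiftEquiv sum_site_dir shift_unshift unshift_shift)
open B2Eq255Concrete (bgScalar256 bgScalar256_eq cutTo cutTo_of_mem cutTo_of_not_mem underRegion mem_underRegion)
open B3Eq116TwoSidedExpansion (opV)
open B3Op116Pieces (fOne fOne_apply mulM mulM_apply covDeriv_add_split norm_mulM_apply_le norm_fOne_apply_le fTwo fTwoAdj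
  norm_fTwoAdj_apply_le norm_fTwo_apply_le)
open B3Op116SourceForm (srcV srcMD srcDM srcMM avgSrc map_srcV opV_apply_eq_srcV norm_mapE_single_le norm_mapE_srcMD_le
  norm_mapE_srcMM_le norm_mapE_avgSrc_le norm_mapE_le_sum_norm_mul_col covDerivAt covDerivAt_apply)
open B3Op116LeibnizRows (pred pred_tgt nMul nMul_apply norm_nMul_apply_le' inv_smul_sum_srcDM_eq)
open B3Ineq210MixedRegularTorus (dip dip_zero)
open B1Ineq225RegularBox (cellBox mem_cellBox)
open B1Eq230FluctCov (Ix cb)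
open B1Eq353SupNorm (norm_avgQkLin_apply_le card_blockK)
open B1TorusCubeCover (half)
open B2Eq273NeumannLocality (avgQk_blockIter_eq_zero)
open B2Eq268HiggsRegion (eq268_identity bgScalar256_eq_zero_of_not_mem row_sums_box)

variable {P : HiggsLattice.Params} {N : ℕ}

/-! ## §1 The multiplier `M_b`, the `D^{ε*}M` source and the field switch under `D` -/

section CutField

variable (C : ChargeData N)

/-- `F_{1,k}(0) = 0` (`U(η, 0) = 1`). [cite: Balaban1982Higgs1, (3.14) p.614] -/
theorem fOne_zero (η : ℝ) : fOne C η 0 = 0 := by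
  rw [show fOne C η 0 = η⁻¹ • (C.U η 0 - 1) from rfl, ChargeData.U_zero, sub_self, smul_zero]

/-- the multiplier `M_b = ε⁻¹U(εB_b)(U(εA_b) − 1)` depends on `A` only through `A_b`. [cite: Balaban1982Higgs1, (3.14) p.614] -/
theorem mulM_congr {A₁ A₂ : HiggsLattice.VecField P 0} (B : HiggsLattice.VecField P 0) {b : HiggsLattice.PBond P 0}
    (h : A₁ b = A₂ b) : mulM C A₁ B b = mulM C A₂ B b :=
  ContinuousLinearMap.ext fun v => by rw [mulM_apply, mulM_apply, h]

/-- `M_b = 0` where `A_b = 0`. [cite: Balaban1982Higgs1, (3.14) p.614] -/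
theorem mulM_apply_eq_zero {A₁ : HiggsLattice.VecField P 0} (B : HiggsLattice.VecField P 0) {b : HiggsLattice.PBond P 0}
    (h : A₁ b = 0) (v : E N) : mulM C A₁ B b v = 0 := by
  rw [mulM_apply, h, fOne_zero, zero_apply, map_zero]

/-- the `D^{ε*}M` source `srcDM_b w = dip_b(M_bw(b₊))` depends on `A` only through `A_b`. [cite: Balaban1982Higgs1, (3.16) p.615] -/
theorem srcDM_congr {A₁ A₂ : HiggsLattice.VecField P 0} (B : HiggsLattice.VecField P 0) {b : HiggsLattice.PBond P 0}
    (h : A₁ b = A₂ b) (w : HiggsLattice.ScalarField P 0 N) : srcDM C A₁ B b w = srcDM C A₂ B b w := by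
  show dip C B b (mulM C A₁ B b (w b.tgt)) = dip C B b (mulM C A₂ B b (w b.tgt))
  rw [mulM_congr C B h]

/-- … and vanishes where `A_b = 0`. [cite: Balaban1982Higgs1, (3.16) p.615] -/
theorem srcDM_eq_zero {A₁ : HiggsLattice.VecField P 0} (B : HiggsLattice.VecField P 0) {b : HiggsLattice.PBond P 0}
    (h : A₁ b = 0) (w : HiggsLattice.ScalarField P 0 N) : srcDM C A₁ B b w = 0 := by
  show dip C B b (mulM C A₁ B b (w b.tgt)) = 0
  rw [mulM_apply_eq_zero C B h, dip_zero]

/-- **THE FIELD SWITCH UNDER THE COVARIANT DERIVATIVE**: `‖(D^ε_{A′+B}f)(b) − (D^ε_Bf)(b)‖ = ‖M_bf(b₊)‖ ≤ |e|s‖f(b₊)‖` for `|A′_b| ≤ s`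
(p40's split (I.3.14) `D_{A′+B} = D_B + M`). [cite: Balaban1982Higgs1, (3.14) p.614] [cite: Balaban1982Higgs2, Lemma 2.4 proof (2.68) p.572] -/
theorem norm_covDeriv_add_sub_le (A' B : HiggsLattice.VecField P 0) {s : ℝ} {b : HiggsLattice.PBond P 0} (hA : |A' b| ≤ s)
    (f : HiggsLattice.ScalarField P 0 N) :
    ‖covDeriv C (A' + B) f b - covDeriv C B f b‖ ≤ |C.e| * s * ‖f b.tgt‖ := by
  rw [covDeriv_add_split, add_sub_cancel_left]
  exact norm_mulM_apply_le C A' B hA _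

end CutField

/-! ## §2 Bookkeeping: bond sums against block-supported weights -/

section Sums

/-- `Σ_y c·1_Ω(y)·κ(y) = c·Σ_{y∈Ω}κ(y)`. [folklore] -/
private theorem sum_ite_mul_eq (Ω : Finset (HiggsLattice.Site P 0)) (c : ℝ) (κ : HiggsLattice.Site P 0 → ℝ) :
    ∑ y : HiggsLattice.Site P 0, (if y ∈ Ω then c * κ y else 0) = c * ∑ y ∈ Ω, κ y := by
  rw [Finset.sum_ite_mem, Finset.univ_inter, Finset.mul_sum]

/-- bond sums read at the sources: `Σ_b 1_S(b₋)f(b₋) = d·Σ_{y∈S}f(y)`. [folklore] -/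
private theorem sum_src_mem_eq (S : Finset (HiggsLattice.Site P 0)) (f : HiggsLattice.Site P 0 → ℝ) :
    ∑ b : HiggsLattice.PBond P 0, (if b.src ∈ S then f b.src else 0) = P.d * ∑ y ∈ S, f y := by
  have h := sum_site_dir (fun (y : HiggsLattice.Site P 0) (_μ : Fin P.d) => if y ∈ S then f y else 0)
  rw [← h]
  simp only [Finset.sum_const, Finset.card_univ, Fintype.card_fin, nsmul_eq_mul]
  rw [← Finset.mul_sum, Finset.sum_ite_mem, Finset.univ_inter]

/-- the inside-bond sum of a weight read at the sources is at most `d` times the site sum over `Ω`. [folklore] -/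
private theorem sum_inside_src_le (Ω : Finset (HiggsLattice.Site P 0)) (κ : HiggsLattice.Site P 0 → ℝ) (hκ : ∀ y, 0 ≤ κ y) :
    ∑ b : HiggsLattice.PBond P 0, (if Inside Ω b then κ b.src else 0) ≤ P.d * ∑ y ∈ Ω, κ y := by
  rw [← sum_src_mem_eq]
  refine Finset.sum_le_sum fun b _ => ?_
  by_cases h : Inside Ω b
  · rw [if_pos h, if_pos h.1]
  · rw [if_neg h]
    split_ifs
    · exact hκ _
    · exact le_rfl

/-- the inside-bond sum of a weight read at the targets is at most `d` times the site sum over `Ω` (F4′'s private lemma, re-proved). [folklore] -/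
private theorem sum_inside_tgt_le (Ω : Finset (HiggsLattice.Site P 0)) (κ : HiggsLattice.Site P 0 → ℝ) (hκ : ∀ y, 0 ≤ κ y) :
    ∑ b : HiggsLattice.PBond P 0, (if Inside Ω b then κ b.tgt else 0) ≤ P.d * ∑ y ∈ Ω, κ y := by
  calc ∑ b : HiggsLattice.PBond P 0, (if Inside Ω b then κ b.tgt else 0)
      ≤ ∑ b : HiggsLattice.PBond P 0, (if b.tgt ∈ Ω then κ b.tgt else 0) := by
        refine Finset.sum_le_sum fun b _ => ?_
        by_cases h : Inside Ω b
        · rw [if_pos h, if_pos h.2]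
        · rw [if_neg h]
          split_ifs
          · exact hκ _
          · exact le_rfl
    _ = ∑ z : HiggsLattice.Site P 0, ∑ μ : Fin P.d, (if z.shift μ ∈ Ω then κ (z.shift μ) else 0) := by
        rw [sum_site_dir]; rfl
    _ = ∑ μ : Fin P.d, ∑ z : HiggsLattice.Site P 0, (if z.shift μ ∈ Ω then κ (z.shift μ) else 0) := Finset.sum_comm
    _ = ∑ _μ : Fin P.d, ∑ y ∈ Ω, κ y := by
        refine Finset.sum_congr rfl fun μ _ => ?_
        rw [Fintype.sum_equiv (shiftEquiv P 0 μ) (fun z => if z.shift μ ∈ Ω then κ (z.shift μ) else 0)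
          (fun y => if y ∈ Ω then κ y else 0) (fun z => rfl), Finset.sum_ite_mem, Finset.univ_inter]
    _ = P.d * ∑ y ∈ Ω, κ y := by rw [Finset.sum_const, Finset.card_univ, Fintype.card_fin, nsmul_eq_mul]

end Sums

/-! ## §3 The two remainder terms of (2.68) under `D_B` at a bond `b₀` -/

section Remainders

variable (C : ChargeData N) {k : ℕ}

/-- **THE `F₂` TERM OF (2.68) UNDER THE DERIVATIVE**: `‖(D_BG_k(□, B)F_{2,k}(A′, B)^*□₁φ)(b₀)‖ ≤ |e|sεd(Lᵏ−1)·t·Σ_{y∈□}Σ_i‖(D_BG_k(□,B)e_{(y,i)})(b₀)‖`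
for `sup_b|A′_b| ≤ s`, `|φ| ≤ t` on `□₁ ⊆ □₂`, `k ≤ K` (F4′'s `norm_T1_le` read through `T′ = (D_B·)(b₀) ∘ G_k(□,B)`).
[cite: Balaban1982Higgs2, Lemma 2.4 proof (2.68) p.572] [cite: Balaban1982Higgs1, (3.15)–(3.16) pp.614–615] -/
theorem norm_T1_deriv_le (hk : k ≤ P.K) {sq₂ sq₁ : Finset (HiggsLattice.Site P k)} (h12 : sq₁ ⊆ sq₂)
    (A' B : HiggsLattice.VecField P 0) {s : ℝ} (hs : 0 ≤ s) (hA : ∀ b : HiggsLattice.PBond P 0, |A' b| ≤ s) (msq a : ℝ)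
    (φ : HiggsLattice.ScalarField P k N) {t : ℝ} (ht : 0 ≤ t) (hφ : ∀ y ∈ sq₁, ‖φ y‖ ≤ t) (b₀ : HiggsLattice.PBond P 0) :
    ‖covDeriv C B (propagatorK C (underRegion k sq₂) B msq a k (fTwoAdj C A' B k (cutTo sq₁ φ))) b₀‖
      ≤ |C.e| * s * P.mesh 0 * (P.d * ((P.L : ℝ) ^ k - 1)) * t *
          ∑ y ∈ underRegion k sq₂, ∑ i : Ix N,
            ‖covDeriv C B (propagatorK C (underRegion k sq₂) B msq a k (cb P N 0 (y, i))) b₀‖ := by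
  set Ω := underRegion k sq₂ with hΩdef
  set m : ℝ := |C.e| * s * P.mesh 0 * (P.d * ((P.L : ℝ) ^ k - 1)) with hm
  set T : HiggsLattice.ScalarField P 0 N →ₗ[ℝ] E N := covDerivAt C B b₀ ∘ₗ propagatorK C Ω B msq a k with hT
  have hTapp : ∀ f, T f = covDeriv C B (propagatorK C Ω B msq a k f) b₀ := fun f => rfl
  have hm0 : 0 ≤ m := by
    have hL1 : (1 : ℝ) ≤ (P.L : ℝ) ^ k := one_le_pow₀ (by exact_mod_cast (P.hL : 1 ≤ P.L))
    have := P.mesh_pos 0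
    rw [hm]
    exact mul_nonneg (by positivity) (mul_nonneg (Nat.cast_nonneg _) (by linarith))
  have h := norm_mapE_le_sum_norm_mul_col T (fTwoAdj C A' B k (cutTo sq₁ φ))
  simp only [hTapp] at h
  refine h.trans ?_
  have hy : ∀ y : HiggsLattice.Site P 0,
      ‖fTwoAdj C A' B k (cutTo sq₁ φ) y‖ * ∑ i : Ix N, ‖covDeriv C B (propagatorK C Ω B msq a k (cb P N 0 (y, i))) b₀‖
        ≤ if y ∈ Ω then m * t * ∑ i : Ix N, ‖covDeriv C B (propagatorK C Ω B msq a k (cb P N 0 (y, i))) b₀‖ else 0 := by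
    intro y
    have hcol : 0 ≤ ∑ i : Ix N, ‖covDeriv C B (propagatorK C Ω B msq a k (cb P N 0 (y, i))) b₀‖ :=
      Finset.sum_nonneg fun _ _ => norm_nonneg _
    have hf := norm_fTwoAdj_apply_le C A' B k hk hs hA (cutTo sq₁ φ) y
    split_ifs with hyΩ
    · refine mul_le_mul_of_nonneg_right (hf.trans (mul_le_mul_of_nonneg_left ?_ hm0)) hcol
      by_cases h1 : blockIter k y ∈ sq₁
      · rw [cutTo_of_mem sq₁ φ h1]; exact hφ _ h1
      · rw [cutTo_of_not_mem sq₁ φ h1, norm_zero]; exact ht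
    · have h1 : blockIter k y ∉ sq₁ := fun h' => hyΩ ((mem_underRegion k sq₂ y).2 (h12 h'))
      rw [cutTo_of_not_mem sq₁ φ h1, norm_zero, mul_zero] at hf
      have h0 : ‖fTwoAdj C A' B k (cutTo sq₁ φ) y‖ = 0 := le_antisymm hf (norm_nonneg _)
      rw [h0, zero_mul]
  refine (Finset.sum_le_sum fun y _ => hy y).trans ?_
  rw [sum_ite_mul_eq]

variable {M' : Type*} [NormedAddCommGroup M'] [NormedSpace ℝ M']

/-- **THE LEIBNIZ CHARGE AT ONE BOND, CASE BY CASE.**  For `A″` the field `A′` cut to the bonds inside `Ω` (`A″_b = A′_b` for `b ⊂ Ω`,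
`A″_b = 0` otherwise), `|A′_b| ≤ s`, `|A′_{⟨z+εe_μ,μ⟩} − A′_{⟨z,μ⟩}| ≤ δ_{A′}` for the collinear pairs `⟨z,μ⟩, ⟨z+εe_μ,μ⟩` of bonds inside
`Ω`, `w` supported in `Ω` with `|w| ≤ W₀`,
`|(D_Bw)(b)| ≤ W₁` on the bonds inside `Ω`, and any weight `κ ≥ 0`:
`‖N_b(A″)w(b₋) − F₁(A″_b)(D_Bw)(b)‖·κ(b₋) ≤ 1_Ω(b₋)·ε⁻¹|e|δ_{A′}W₀κ(b₋) + 1_{∂Ω}(b₋)·ε⁻¹|e|sW₀κ(b₋) + 1_{b⊂Ω}·|e|sW₁κ(b₋)`,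
`∂Ω = {y ∈ Ω : ∃μ, y + εe_μ ∉ Ω ∨ y − εe_μ ∉ Ω}` (both `b`, `b − e_μ` inside: regularity; exactly one inside: `b₋ ∈ ∂Ω` and one of the
two potentials is zero; neither: the charge vanishes). [cite: Balaban1982Higgs1, (3.14) p.614, (3.16) p.615, (2.23) p.610]
[cite: Balaban1982Higgs2, (2.60) p.571, Lemma 2.4 proof (2.68) p.572] -/
theorem norm_leibniz_bond_le (Ω : Finset (HiggsLattice.Site P 0)) (A' A'' B : HiggsLattice.VecField P 0)
    (hin : ∀ b : HiggsLattice.PBond P 0, Inside Ω b → A'' b = A' b) (hout : ∀ b : HiggsLattice.PBond P 0, ¬Inside Ω b → A'' b = 0)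
    {s : ℝ} (hs : 0 ≤ s) (hA : ∀ b : HiggsLattice.PBond P 0, |A' b| ≤ s) {δA : ℝ} (hδA : 0 ≤ δA)
    (hregA : ∀ (z : HiggsLattice.Site P 0) (μ : Fin P.d), Inside Ω ⟨z, μ⟩ → Inside Ω ⟨z.shift μ, μ⟩ →
      |A' ⟨z.shift μ, μ⟩ - A' ⟨z, μ⟩| ≤ δA)
    (w : HiggsLattice.ScalarField P 0 N) (hw0 : ∀ y, y ∉ Ω → w y = 0) {W₀ W₁ : ℝ} (hW₀ : ∀ y, ‖w y‖ ≤ W₀) (hW₁nn : 0 ≤ W₁)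
    (hW₁ : ∀ b : HiggsLattice.PBond P 0, Inside Ω b → ‖covDeriv C B w b‖ ≤ W₁)
    (κ : HiggsLattice.Site P 0 → ℝ) (hκ : ∀ y, 0 ≤ κ y) (b : HiggsLattice.PBond P 0) :
    ‖nMul C A'' b (w b.src) - fOne C (P.mesh 0) (A'' b) (covDeriv C B w b)‖ * κ b.src
      ≤ (if b.src ∈ Ω then (P.mesh 0)⁻¹ * (|C.e| * δA) * W₀ * κ b.src else 0)
        + (if b.src ∈ Ω.filter (fun y => ∃ μ : Fin P.d, y.shift μ ∉ Ω ∨ y.unshift μ ∉ Ω)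
            then (P.mesh 0)⁻¹ * (|C.e| * s) * W₀ * κ b.src else 0)
        + (if Inside Ω b then |C.e| * s * W₁ * κ b.src else 0) := by
  have hε : 0 < P.mesh 0 := P.mesh_pos 0
  have hεi : 0 ≤ (P.mesh 0)⁻¹ := inv_nonneg.2 hε.le
  have he : 0 ≤ |C.e| := abs_nonneg _
  have hW₀0 : 0 ≤ W₀ := (norm_nonneg _).trans (hW₀ b.src)
  have hκb : 0 ≤ κ b.src := hκ _
  -- the three indicator terms are nonnegative
  have hI1 : 0 ≤ (if b.src ∈ Ω then (P.mesh 0)⁻¹ * (|C.e| * δA) * W₀ * κ b.src else 0) := by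
    split_ifs
    · positivity
    · exact le_rfl
  have hI2 : 0 ≤ (if b.src ∈ Ω.filter (fun y => ∃ μ : Fin P.d, y.shift μ ∉ Ω ∨ y.unshift μ ∉ Ω)
      then (P.mesh 0)⁻¹ * (|C.e| * s) * W₀ * κ b.src else 0) := by
    split_ifs
    · positivity
    · exact le_rfl
  have hI3 : 0 ≤ (if Inside Ω b then |C.e| * s * W₁ * κ b.src else 0) := by
    split_ifs
    · positivity
    · exact le_rfl
  -- the `F₁(A″_b)(D_Bw)(b)` part
  have hF : ‖fOne C (P.mesh 0) (A'' b) (covDeriv C B w b)‖ * κ b.src ≤ (if Inside Ω b then |C.e| * s * W₁ * κ b.src else 0) := by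
    split_ifs with hb
    · refine mul_le_mul_of_nonneg_right ?_ hκb
      refine (norm_fOne_apply_le C hε.ne' (A'' b) _).trans ?_
      rw [hin b hb]
      exact mul_le_mul (mul_le_mul_of_nonneg_left (hA b) he) (hW₁ b hb) (norm_nonneg _) (mul_nonneg he hs)
    · rw [hout b hb, fOne_zero, zero_apply, norm_zero, zero_mul]
  -- the `N_b w(b₋)` part
  have hNb : ‖nMul C A'' b (w b.src)‖ * κ b.src
      ≤ (if b.src ∈ Ω then (P.mesh 0)⁻¹ * (|C.e| * δA) * W₀ * κ b.src else 0)
        + (if b.src ∈ Ω.filter (fun y => ∃ μ : Fin P.d, y.shift μ ∉ Ω ∨ y.unshift μ ∉ Ω)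
            then (P.mesh 0)⁻¹ * (|C.e| * s) * W₀ * κ b.src else 0) := by
    by_cases hy : b.src ∈ Ω
    · have hN := norm_nMul_apply_le' C A'' b (w b.src)
      by_cases hb : Inside Ω b <;> by_cases hp : Inside Ω (pred b)
      · -- both inside: the regularity of `A′`
        have hdiff : |A'' (pred b) - A'' b| ≤ δA := by
          rw [hin _ hp, hin _ hb, abs_sub_comm]
          have hb' : Inside Ω ⟨(b.src.unshift b.dir).shift b.dir, b.dir⟩ := by rw [shift_unshift]; exact hb
          have h := hregA (b.src.unshift b.dir) b.dir hp hb'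
          simp only [shift_unshift] at h
          exact h
        rw [if_pos hy]
        refine le_add_of_le_of_nonneg ?_ hI2
        refine (mul_le_mul_of_nonneg_right hN hκb).trans ?_
        have h1 : |C.e| * |A'' (pred b) - A'' b| * ‖w b.src‖ ≤ |C.e| * δA * W₀ :=
          mul_le_mul (mul_le_mul_of_nonneg_left hdiff he) (hW₀ _) (norm_nonneg _) (mul_nonneg he hδA)
        nlinarith [mul_le_mul_of_nonneg_left h1 hεi]
      · -- `b` inside, `b − e_μ` not: `A″_{b−e_μ} = 0`, `b₋ ∈ ∂Ω`
        have hdiff : |A'' (pred b) - A'' b| ≤ s := by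
          rw [hout _ hp, hin _ hb, zero_sub, abs_neg]; exact hA b
        have hlay : b.src ∈ Ω.filter (fun y => ∃ μ : Fin P.d, y.shift μ ∉ Ω ∨ y.unshift μ ∉ Ω) := by
          rw [Finset.mem_filter]
          refine ⟨hy, b.dir, Or.inr fun h => hp ⟨h, ?_⟩⟩
          rw [pred_tgt]; exact hy
        rw [if_pos hlay]
        refine le_add_of_nonneg_of_le hI1 ?_
        refine (mul_le_mul_of_nonneg_right hN hκb).trans ?_
        have h1 : |C.e| * |A'' (pred b) - A'' b| * ‖w b.src‖ ≤ |C.e| * s * W₀ :=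
          mul_le_mul (mul_le_mul_of_nonneg_left hdiff he) (hW₀ _) (norm_nonneg _) (mul_nonneg he hs)
        nlinarith [mul_le_mul_of_nonneg_left h1 hεi]
      · -- `b − e_μ` inside, `b` not: `A″_b = 0`, `b₊ ∉ Ω`, `b₋ ∈ ∂Ω`
        have hdiff : |A'' (pred b) - A'' b| ≤ s := by
          rw [hout _ hb, hin _ hp, sub_zero]; exact hA _
        have hlay : b.src ∈ Ω.filter (fun y => ∃ μ : Fin P.d, y.shift μ ∉ Ω ∨ y.unshift μ ∉ Ω) := by
          rw [Finset.mem_filter]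
          exact ⟨hy, b.dir, Or.inl fun h => hb ⟨hy, h⟩⟩
        rw [if_pos hlay]
        refine le_add_of_nonneg_of_le hI1 ?_
        refine (mul_le_mul_of_nonneg_right hN hκb).trans ?_
        have h1 : |C.e| * |A'' (pred b) - A'' b| * ‖w b.src‖ ≤ |C.e| * s * W₀ :=
          mul_le_mul (mul_le_mul_of_nonneg_left hdiff he) (hW₀ _) (norm_nonneg _) (mul_nonneg he hs)
        nlinarith [mul_le_mul_of_nonneg_left h1 hεi]
      · -- neither inside: the charge vanishes
        have h0 : nMul C A'' b (w b.src) = 0 := by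
          rw [nMul_apply, hout _ hp, hout _ hb, sub_self, smul_zero]
        rw [h0, norm_zero, zero_mul]
        exact add_nonneg hI1 hI2
    · -- `b₋ ∉ Ω`: `w(b₋) = 0`
      rw [hw0 _ hy, map_zero, norm_zero, zero_mul]
      exact add_nonneg hI1 hI2
  calc ‖nMul C A'' b (w b.src) - fOne C (P.mesh 0) (A'' b) (covDeriv C B w b)‖ * κ b.src
      ≤ (‖nMul C A'' b (w b.src)‖ + ‖fOne C (P.mesh 0) (A'' b) (covDeriv C B w b)‖) * κ b.src :=
        mul_le_mul_of_nonneg_right (norm_sub_le _ _) hκb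
    _ = ‖nMul C A'' b (w b.src)‖ * κ b.src + ‖fOne C (P.mesh 0) (A'' b) (covDeriv C B w b)‖ * κ b.src := by ring
    _ ≤ _ := add_le_add hNb hF

/-- **THE `D^{ε*}M` SOURCES OF `V_k(A′,B)w` ON `Ω` THROUGH A LINEAR `T`, IN LEIBNIZ FORM**: with `κ_T(y) = Σ_i‖Te_{(y,i)}‖`,
`‖Σ_{b⊂Ω}ε⁻¹T(srcDM_b w)‖ ≤ d·[ε⁻¹|e|δ_{A′}W₀ + |e|sW₁]·Σ_{y∈Ω}κ_T(y) + d·ε⁻¹|e|sW₀·Σ_{y∈∂Ω}κ_T(y)`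
(the inside sources are ALL the sources of the cut field `A″ = A′1_{b⊂Ω}`; p35's THEOREM A′ `inv_smul_sum_srcDM_eq` for `A″`; the bond lemma).
[cite: Balaban1982Higgs1, (3.14)–(3.16) pp.614–615] [cite: Balaban1983Higgs3, (1.16) p.414] [cite: Balaban1982Higgs2, Lemma 2.4 proof (2.68) p.572] -/
theorem norm_sum_srcDM_map_le (T : HiggsLattice.ScalarField P 0 N →ₗ[ℝ] M') (Ω : Finset (HiggsLattice.Site P 0))
    (A' B : HiggsLattice.VecField P 0) {s : ℝ} (hs : 0 ≤ s) (hA : ∀ b : HiggsLattice.PBond P 0, |A' b| ≤ s) {δA : ℝ} (hδA : 0 ≤ δA)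
    (hregA : ∀ (z : HiggsLattice.Site P 0) (μ : Fin P.d), Inside Ω ⟨z, μ⟩ → Inside Ω ⟨z.shift μ, μ⟩ →
      |A' ⟨z.shift μ, μ⟩ - A' ⟨z, μ⟩| ≤ δA)
    (w : HiggsLattice.ScalarField P 0 N) (hw0 : ∀ y, y ∉ Ω → w y = 0) {W₀ W₁ : ℝ} (hW₀ : ∀ y, ‖w y‖ ≤ W₀) (hW₁nn : 0 ≤ W₁)
    (hW₁ : ∀ b : HiggsLattice.PBond P 0, Inside Ω b → ‖covDeriv C B w b‖ ≤ W₁) :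
    ‖∑ b : HiggsLattice.PBond P 0, (if Inside Ω b then (P.mesh 0)⁻¹ • T (srcDM C A' B b w) else 0)‖
      ≤ P.d * ((P.mesh 0)⁻¹ * (|C.e| * δA) * W₀ + |C.e| * s * W₁) * ∑ y ∈ Ω, ∑ i : Ix N, ‖T (cb P N 0 (y, i))‖
        + P.d * ((P.mesh 0)⁻¹ * (|C.e| * s) * W₀) *
            ∑ y ∈ Ω.filter (fun y => ∃ μ : Fin P.d, y.shift μ ∉ Ω ∨ y.unshift μ ∉ Ω), ∑ i : Ix N, ‖T (cb P N 0 (y, i))‖ := by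
  set A'' : HiggsLattice.VecField P 0 := fun b => if Inside Ω b then A' b else 0 with hA''
  have hin : ∀ b : HiggsLattice.PBond P 0, Inside Ω b → A'' b = A' b := fun b hb => if_pos hb
  have hout : ∀ b : HiggsLattice.PBond P 0, ¬Inside Ω b → A'' b = 0 := fun b hb => if_neg hb
  set col : HiggsLattice.Site P 0 → ℝ := fun y => ∑ i : Ix N, ‖T (cb P N 0 (y, i))‖ with hcol
  have hcol0 : ∀ y, 0 ≤ col y := fun y => Finset.sum_nonneg fun _ _ => norm_nonneg _
  set L := Ω.filter (fun y => ∃ μ : Fin P.d, y.shift μ ∉ Ω ∨ y.unshift μ ∉ Ω) with hL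
  -- the inside sources of `A′` are all the sources of `A″`
  have hterm : ∀ b : HiggsLattice.PBond P 0,
      (if Inside Ω b then (P.mesh 0)⁻¹ • T (srcDM C A' B b w) else 0) = (P.mesh 0)⁻¹ • T (srcDM C A'' B b w) := by
    intro b
    split_ifs with hb
    · rw [srcDM_congr C B (hin b hb)]
    · rw [srcDM_eq_zero C B (hout b hb), map_zero, smul_zero]
  have hsum : ∑ b : HiggsLattice.PBond P 0, (if Inside Ω b then (P.mesh 0)⁻¹ • T (srcDM C A' B b w) else 0)
      = ∑ b : HiggsLattice.PBond P 0,
          T (Pi.single b.src (nMul C A'' b (w b.src) - fOne C (P.mesh 0) (A'' b) (covDeriv C B w b))) := by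
    rw [Finset.sum_congr rfl fun b _ => hterm b, ← Finset.smul_sum, ← map_sum, ← map_smul, inv_smul_sum_srcDM_eq, map_sum]
  rw [hsum]
  -- bond by bond
  have hb := norm_leibniz_bond_le C Ω A' A'' B hin hout hs hA hδA hregA w hw0 hW₀ hW₁nn hW₁ col hcol0
  calc ‖∑ b : HiggsLattice.PBond P 0,
          T (Pi.single b.src (nMul C A'' b (w b.src) - fOne C (P.mesh 0) (A'' b) (covDeriv C B w b)))‖
      ≤ ∑ b : HiggsLattice.PBond P 0,
          ‖nMul C A'' b (w b.src) - fOne C (P.mesh 0) (A'' b) (covDeriv C B w b)‖ * col b.src :=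
        (norm_sum_le _ _).trans (Finset.sum_le_sum fun b _ => norm_mapE_single_le T b.src _)
    _ ≤ ∑ b : HiggsLattice.PBond P 0,
          ((if b.src ∈ Ω then (P.mesh 0)⁻¹ * (|C.e| * δA) * W₀ * col b.src else 0)
            + (if b.src ∈ L then (P.mesh 0)⁻¹ * (|C.e| * s) * W₀ * col b.src else 0)
            + (if Inside Ω b then |C.e| * s * W₁ * col b.src else 0)) := Finset.sum_le_sum fun b _ => hb b
    _ = P.d * ∑ y ∈ Ω, (P.mesh 0)⁻¹ * (|C.e| * δA) * W₀ * col y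
          + P.d * ∑ y ∈ L, (P.mesh 0)⁻¹ * (|C.e| * s) * W₀ * col y
          + ∑ b : HiggsLattice.PBond P 0, (if Inside Ω b then |C.e| * s * W₁ * col b.src else 0) := by
        rw [Finset.sum_add_distrib, Finset.sum_add_distrib,
          sum_src_mem_eq Ω (fun y => (P.mesh 0)⁻¹ * (|C.e| * δA) * W₀ * col y),
          sum_src_mem_eq L (fun y => (P.mesh 0)⁻¹ * (|C.e| * s) * W₀ * col y)]
    _ ≤ P.d * ∑ y ∈ Ω, (P.mesh 0)⁻¹ * (|C.e| * δA) * W₀ * col y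
          + P.d * ∑ y ∈ L, (P.mesh 0)⁻¹ * (|C.e| * s) * W₀ * col y
          + P.d * ∑ y ∈ Ω, |C.e| * s * W₁ * col y := by
        refine add_le_add le_rfl (sum_inside_src_le Ω (fun y => |C.e| * s * W₁ * col y) fun y => ?_)
        exact mul_nonneg (mul_nonneg (mul_nonneg (abs_nonneg _) hs) hW₁nn) (hcol0 y)
    _ = P.d * ((P.mesh 0)⁻¹ * (|C.e| * δA) * W₀ + |C.e| * s * W₁) * ∑ y ∈ Ω, col y
          + P.d * ((P.mesh 0)⁻¹ * (|C.e| * s) * W₀) * ∑ y ∈ L, col y := by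
        rw [← Finset.mul_sum, ← Finset.mul_sum, ← Finset.mul_sum]
        ring

/-- **THE `V_k` TERM OF (2.68) UNDER THE DERIVATIVE**: for `Ω` a union of `k`-blocks, `w` supported in `Ω` with `|w| ≤ W₀`,
`|(D_Bw)(b)| ≤ W₁` on the bonds inside `Ω`, `sup_b|A′_b| ≤ s`, `|A′_{⟨z+εe_μ,μ⟩} − A′_{⟨z,μ⟩}| ≤ δ_{A′}` for the collinear pairs of bonds
inside `Ω`, `k ≤ K`, every bond `b₀`:
`‖(D_BG_k(Ω,B)V_k(A′,B)w)(b₀)‖ ≤ [|e|sd(2W₁ + |e|sW₀) + ε⁻¹|e|δ_{A′}dW₀ + |a_k|ℓ⁻²(2m + m²)W₀]·Σ_{y∈Ω}κ′(y) + ε⁻¹|e|sdW₀·Σ_{y∈∂Ω}κ′(y)`,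
`κ′(y) = Σ_i‖(D_BG_k(Ω,B)e_{(y,i)})(b₀)‖`, `m = |e|sεd(Lᵏ−1)`, `∂Ω = {y ∈ Ω : ∃μ, y ± εe_μ ∉ Ω}` (r14's source form through
`T′ = (D_B·)(b₀) ∘ G_k(Ω,B)`: the `M^*D`, `M^*M` and averaging sources as in F4′'s `norm_T2_le`, the `D^{ε*}M` sources in Leibniz form).
[cite: Balaban1982Higgs2, Lemma 2.4 proof (2.68) p.572] [cite: Balaban1982Higgs1, (3.16) p.615, (3.44) p.619] -/
theorem norm_T2_deriv_le (hk : k ≤ P.K) {Ω : Finset (HiggsLattice.Site P 0)}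
    (hΩ : ∀ x x' : HiggsLattice.Site P 0, blockIter k x = blockIter k x' → (x ∈ Ω ↔ x' ∈ Ω))
    (A' B : HiggsLattice.VecField P 0) {s : ℝ} (hs : 0 ≤ s) (hA : ∀ b : HiggsLattice.PBond P 0, |A' b| ≤ s) {δA : ℝ} (hδA : 0 ≤ δA)
    (hregA : ∀ (z : HiggsLattice.Site P 0) (μ : Fin P.d), Inside Ω ⟨z, μ⟩ → Inside Ω ⟨z.shift μ, μ⟩ →
      |A' ⟨z.shift μ, μ⟩ - A' ⟨z, μ⟩| ≤ δA) (msq a : ℝ)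
    (w : HiggsLattice.ScalarField P 0 N) (hw0 : ∀ y, y ∉ Ω → w y = 0) {W₀ W₁ : ℝ} (hW₀ : ∀ y, ‖w y‖ ≤ W₀)
    (hW₁nn : 0 ≤ W₁) (hW₁ : ∀ b : HiggsLattice.PBond P 0, Inside Ω b → ‖covDeriv C B w b‖ ≤ W₁)
    (b₀ : HiggsLattice.PBond P 0) :
    ‖covDeriv C B (propagatorK C Ω B msq a k (opV C Ω A' B msq a k w)) b₀‖
      ≤ (|C.e| * s * (P.d * (2 * W₁ + |C.e| * s * W₀)) + (P.mesh 0)⁻¹ * (|C.e| * δA) * (P.d * W₀)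
          + |B1.aSeq a P.L k| * (P.mesh k)⁻¹ ^ 2 *
              ((2 * (|C.e| * s * P.mesh 0 * (P.d * ((P.L : ℝ) ^ k - 1)))
                + (|C.e| * s * P.mesh 0 * (P.d * ((P.L : ℝ) ^ k - 1))) ^ 2) * W₀)) *
            ∑ y ∈ Ω, ∑ i : Ix N, ‖covDeriv C B (propagatorK C Ω B msq a k (cb P N 0 (y, i))) b₀‖
        + (P.mesh 0)⁻¹ * (|C.e| * s) * (P.d * W₀) *
            ∑ y ∈ Ω.filter (fun y => ∃ μ : Fin P.d, y.shift μ ∉ Ω ∨ y.unshift μ ∉ Ω),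
              ∑ i : Ix N, ‖covDeriv C B (propagatorK C Ω B msq a k (cb P N 0 (y, i))) b₀‖ := by
  set m : ℝ := |C.e| * s * P.mesh 0 * (P.d * ((P.L : ℝ) ^ k - 1)) with hm
  set T : HiggsLattice.ScalarField P 0 N →ₗ[ℝ] E N := covDerivAt C B b₀ ∘ₗ propagatorK C Ω B msq a k with hT
  have hTapp : ∀ f, T f = covDeriv C B (propagatorK C Ω B msq a k f) b₀ := fun f => rfl
  set col : HiggsLattice.Site P 0 → ℝ := fun y => ∑ i : Ix N, ‖T (cb P N 0 (y, i))‖ with hcol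
  have hcolapp : ∀ y, col y = ∑ i : Ix N, ‖covDeriv C B (propagatorK C Ω B msq a k (cb P N 0 (y, i))) b₀‖ := fun y => rfl
  set L := Ω.filter (fun y => ∃ μ : Fin P.d, y.shift μ ∉ Ω ∨ y.unshift μ ∉ Ω) with hL
  have hcol0 : ∀ y, 0 ≤ col y := fun y => Finset.sum_nonneg fun _ _ => norm_nonneg _
  have hW₀0 : 0 ≤ W₀ := (norm_nonneg _).trans (hW₀ b₀.src)
  have hes : 0 ≤ |C.e| * s := mul_nonneg (abs_nonneg _) hs
  have hm0 : 0 ≤ m := by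
    have hL1 : (1 : ℝ) ≤ (P.L : ℝ) ^ k := one_le_pow₀ (by exact_mod_cast (P.hL : 1 ≤ P.L))
    have := P.mesh_pos 0
    rw [hm]
    exact mul_nonneg (by positivity) (mul_nonneg (Nat.cast_nonneg _) (by linarith))
  -- the source form, separated through `T`
  have hgoal : covDeriv C B (propagatorK C Ω B msq a k (opV C Ω A' B msq a k w)) b₀ = T (srcV C A' B k Ω a w) := by
    rw [hTapp, opV_apply_eq_srcV C A' B msq w]
  rw [hgoal, map_srcV]
  have hsplit : (∑ b : HiggsLattice.PBond P 0, if Inside Ω b then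
        T (srcMD C A' B b w) + (P.mesh 0)⁻¹ • T (srcDM C A' B b w) + T (srcMM C A' B b w) else 0)
      = (∑ b : HiggsLattice.PBond P 0, if Inside Ω b then T (srcMD C A' B b w) else 0)
        + (∑ b : HiggsLattice.PBond P 0, if Inside Ω b then (P.mesh 0)⁻¹ • T (srcDM C A' B b w) else 0)
        + (∑ b : HiggsLattice.PBond P 0, if Inside Ω b then T (srcMM C A' B b w) else 0) := by
    rw [← Finset.sum_add_distrib, ← Finset.sum_add_distrib]
    refine Finset.sum_congr rfl fun b _ => ?_
    split_ifs
    · rfl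
    · rw [add_zero, add_zero]
  rw [hsplit]
  -- (i) the `M^*D` sources
  have hS1 : ‖∑ b : HiggsLattice.PBond P 0, (if Inside Ω b then T (srcMD C A' B b w) else 0)‖
      ≤ |C.e| * s * W₁ * (P.d * ∑ y ∈ Ω, col y) := by
    calc ‖∑ b : HiggsLattice.PBond P 0, (if Inside Ω b then T (srcMD C A' B b w) else 0)‖
        ≤ ∑ b : HiggsLattice.PBond P 0, ‖(if Inside Ω b then T (srcMD C A' B b w) else 0)‖ := norm_sum_le _ _
      _ ≤ ∑ b : HiggsLattice.PBond P 0, (if Inside Ω b then |C.e| * s * W₁ * col b.tgt else 0) := by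
          refine Finset.sum_le_sum fun b _ => ?_
          split_ifs with hb
          · refine (norm_mapE_srcMD_le C A' B T (hA b) w).trans ?_
            exact mul_le_mul_of_nonneg_right (mul_le_mul_of_nonneg_left (hW₁ b hb) hes) (hcol0 _)
          · rw [norm_zero]
      _ ≤ P.d * ∑ y ∈ Ω, |C.e| * s * W₁ * col y :=
          sum_inside_tgt_le Ω (fun y => |C.e| * s * W₁ * col y) fun y => mul_nonneg (mul_nonneg hes hW₁nn) (hcol0 y)
      _ = |C.e| * s * W₁ * (P.d * ∑ y ∈ Ω, col y) := by rw [← Finset.mul_sum]; ring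
  -- (ii) the `D^*M` sources in Leibniz form
  have hS2 := norm_sum_srcDM_map_le C T Ω A' B hs hA hδA hregA w hw0 hW₀ hW₁nn hW₁
  -- (iii) the `M^*M` sources
  have hS3 : ‖∑ b : HiggsLattice.PBond P 0, (if Inside Ω b then T (srcMM C A' B b w) else 0)‖
      ≤ (|C.e| * s) ^ 2 * W₀ * (P.d * ∑ y ∈ Ω, col y) := by
    calc ‖∑ b : HiggsLattice.PBond P 0, (if Inside Ω b then T (srcMM C A' B b w) else 0)‖
        ≤ ∑ b : HiggsLattice.PBond P 0, ‖(if Inside Ω b then T (srcMM C A' B b w) else 0)‖ := norm_sum_le _ _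
      _ ≤ ∑ b : HiggsLattice.PBond P 0, (if Inside Ω b then (|C.e| * s) ^ 2 * W₀ * col b.tgt else 0) := by
          refine Finset.sum_le_sum fun b _ => ?_
          split_ifs with hb
          · refine (norm_mapE_srcMM_le C A' B T (hA b) w).trans ?_
            exact mul_le_mul_of_nonneg_right (mul_le_mul_of_nonneg_left (hW₀ _) (sq_nonneg _)) (hcol0 _)
          · rw [norm_zero]
      _ ≤ P.d * ∑ y ∈ Ω, (|C.e| * s) ^ 2 * W₀ * col y :=
          sum_inside_tgt_le Ω (fun y => (|C.e| * s) ^ 2 * W₀ * col y) fun y => mul_nonneg (by positivity) (hcol0 y)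
      _ = (|C.e| * s) ^ 2 * W₀ * (P.d * ∑ y ∈ Ω, col y) := by rw [← Finset.mul_sum]; ring
  -- (iv) the averaging sources (as F4′, through `T′`)
  have havg := norm_mapE_avgSrc_le (C := C) (A := A') (B := B) (k := k) T hk hs hA w
  have hQ0 : ∀ y : HiggsLattice.Site P 0, y ∉ Ω → ∀ X : HiggsLattice.VecField P 0, avgQkLin C X k w (blockIter k y) = 0 := by
    intro y hy X
    rw [HiggsCovariance.avgQkLin_apply]
    exact avgQk_blockIter_eq_zero C hΩ X w hw0 hy
  have hF0 : ∀ y : HiggsLattice.Site P 0, y ∉ Ω → fTwo C A' B k w (blockIter k y) = 0 := by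
    intro y hy
    rw [fTwo, LinearMap.sub_apply, Pi.sub_apply, hQ0 y hy, hQ0 y hy, sub_zero]
  have hmean : ∀ y' : HiggsLattice.Site P k, ‖fTwo C A' B k w y'‖ ≤ m * W₀ := by
    intro y'
    refine (norm_fTwo_apply_le C A' B k hk hs hA w y').trans (mul_le_mul_of_nonneg_left ?_ hm0)
    have hLp : (0 : ℝ) < (P.L : ℝ) ^ (k * P.d) := pow_pos (by exact_mod_cast P.hL) _
    rw [inv_mul_le_iff₀ hLp]
    calc ∑ x ∈ blockK k y', ‖w x‖ ≤ ∑ _x ∈ blockK k y', W₀ := Finset.sum_le_sum fun z _ => hW₀ z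
      _ = (P.L : ℝ) ^ (k * P.d) * W₀ := by
          rw [Finset.sum_const, card_blockK hk, nsmul_eq_mul]; push_cast; ring
  have hyavg : ∀ y : HiggsLattice.Site P 0,
      (m * ‖avgQkLin C B k w (blockIter k y)‖ + ‖fTwo C A' B k w (blockIter k y)‖
          + m * ‖fTwo C A' B k w (blockIter k y)‖) * col y
        ≤ if y ∈ Ω then (2 * m + m ^ 2) * W₀ * col y else 0 := by
    intro y
    split_ifs with hy
    · refine mul_le_mul_of_nonneg_right ?_ (hcol0 y)
      have h1 : ‖avgQkLin C B k w (blockIter k y)‖ ≤ W₀ := norm_avgQkLin_apply_le C B hk w hW₀ _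
      have h2 := hmean (blockIter k y)
      nlinarith [mul_le_mul_of_nonneg_left h1 hm0, mul_le_mul_of_nonneg_left h2 hm0,
        norm_nonneg (fTwo C A' B k w (blockIter k y))]
    · rw [hQ0 y hy B, hF0 y hy, norm_zero, mul_zero, add_zero, add_zero, zero_mul]
  have hS4 : ‖T (avgSrc C A' B k w)‖ ≤ (2 * m + m ^ 2) * W₀ * ∑ y ∈ Ω, col y := by
    refine havg.trans ((Finset.sum_le_sum fun y _ => hyavg y).trans (le_of_eq ?_))
    rw [sum_ite_mul_eq]
  -- assemble
  have hak : 0 ≤ |B1.aSeq a P.L k| * (P.mesh k)⁻¹ ^ 2 := by positivity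
  have hnorm : ‖-((∑ b : HiggsLattice.PBond P 0, if Inside Ω b then T (srcMD C A' B b w) else 0)
        + (∑ b : HiggsLattice.PBond P 0, if Inside Ω b then (P.mesh 0)⁻¹ • T (srcDM C A' B b w) else 0)
        + (∑ b : HiggsLattice.PBond P 0, if Inside Ω b then T (srcMM C A' B b w) else 0))
        - (B1.aSeq a P.L k * (P.mesh k)⁻¹ ^ 2) • T (avgSrc C A' B k w)‖
      ≤ ‖∑ b : HiggsLattice.PBond P 0, (if Inside Ω b then T (srcMD C A' B b w) else 0)‖
        + ‖∑ b : HiggsLattice.PBond P 0, (if Inside Ω b then (P.mesh 0)⁻¹ • T (srcDM C A' B b w) else 0)‖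
        + ‖∑ b : HiggsLattice.PBond P 0, (if Inside Ω b then T (srcMM C A' B b w) else 0)‖
        + |B1.aSeq a P.L k| * (P.mesh k)⁻¹ ^ 2 * ‖T (avgSrc C A' B k w)‖ := by
    refine (norm_sub_le _ _).trans (add_le_add ?_ (le_of_eq ?_))
    · rw [norm_neg]
      exact (norm_add_le _ _).trans (add_le_add ((norm_add_le _ _).trans le_rfl) le_rfl)
    · rw [norm_smul, Real.norm_eq_abs, abs_mul, abs_of_nonneg (pow_nonneg (inv_nonneg.mpr (P.mesh_pos k).le) 2)]
  refine hnorm.trans ?_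
  have hcb : ∀ (y : HiggsLattice.Site P 0) (i : Ix N),
      ‖T (cb P N 0 (y, i))‖ = ‖covDeriv C B (propagatorK C Ω B msq a k (cb P N 0 (y, i))) b₀‖ := fun _ _ => rfl
  simp only [hcb] at hS2
  rw [← hL] at hS2
  simp only [hcolapp] at hS1 hS3 hS4
  linarith [hS1, hS2, hS3, mul_le_mul_of_nonneg_left hS4 hak]

end Remainders

/-! ## §4 (2.68) «similarly for the derivative» with explicit remainder on a cell-product box -/

section Eq268Deriv

/-- **(2.68) FOR THE COVARIANT DERIVATIVE ON THE (Higgs)₂,₃ CARRIER — THE REMAINDER BOUNDED** (ε-lattice currency, `ℓ = Lᵏε`,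
`κ = a_kℓ⁻²`, `m = |e|sεd(Lᵏ−1)`).  For `d ≥ 1`, `L ≥ 2`, `a, m² > 0`, `N`, charge data: there are `K₀min` and, per `K₀ ≥ K₀min`, a
threshold `t > 0` and constants `C₁, C₂ ≥ 0` (F4′'s `row_sums_box`) such that on every torus of the carrier with `K₀ ∣ M`, at every level
`1 ≤ k ≤ K_P` with `3LᵏK₀ ≤ |T_ε|_μ`, `Lᵏε ≤ 1`, for every pair `□₁ ⊆ □₂ ⊂ T^{(k)}` with `□ = Bᵏ(□₂)` a cell-product box of big blocks, every
background `B` with `|B(z+εe_ν,μ) − B(z,μ)| ≤ δ_B` on `□` and `Lᵏδ_B|e| ≤ t` (print: the constant `A₀`, `δ_B = 0`), every `A′` with `|A′_b| ≤ s`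
and `|A′(z+εe_μ,μ) − A′(z,μ)| ≤ δ_{A′}` for the collinear pairs `⟨z,μ⟩, ⟨z+εe_μ,μ⟩` of bonds inside `□` (print's (2.60)), every `φ` with
`|φ| ≤ t′` on `□₁`, all bounds `|w| ≤ W₀`, `|(D_Bw)(b)| ≤ W₁`
(`b ⊂ □`, `W₁ ≥ 0`) for `w = φ^{(k)}_□ = a_kG_k(□, A′+B)Q_k^*(A′+B)□₁φ`, and every bond `b₀ ⊂ □`:
`‖(D_{A′+B}(a_kG_k(□,A′+B)Q_k^*(A′+B)□₁φ))(b₀) − (D_B(a_kG_k(□,B)Q_k^*(B)□₁φ))(b₀)‖ ≤ |e|sW₀ + C₂ℓ·[κmt′ + |e|sd(2W₁ + |e|sW₀) +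
ε⁻¹|e|δ_{A′}dW₀ + κ(2m + m²)W₀] + ε⁻¹|e|sdW₀·Σ_{y∈∂□}Σ_i‖(D_BG_k(□,B)e_{(y,i)})(b₀)‖`, `∂□ = {y ∈ □ : ∃μ, y ± εe_μ ∉ □}` — print's
«(2.68) and similarly for the derivative» with the remainder explicit and the Neumann boundary-layer column kept as displayed.
[cite: Balaban1982Higgs2, Lemma 2.4 proof (2.68) p.572, (2.77) p.573] [cite: Balaban1982Higgs1, (3.14) p.614, (3.44) p.619]
[cite: Balaban1983Higgs3, (2.10) p.426] -/
theorem eq268_deriv_box (d L : ℕ) (hd : 1 ≤ d) (hL : 2 ≤ L) {a : ℝ} (ha : 0 < a) {msq : ℝ} (hmsq : 0 < msq)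
    (N : ℕ) (C : ChargeData N) :
    ∃ K₀min : ℕ, ∀ K₀ : ℕ, K₀min ≤ K₀ → ∃ t C₁ C₂ : ℝ, 0 < t ∧ 0 ≤ C₁ ∧ 0 ≤ C₂ ∧
      ∀ (P : HiggsLattice.Params), P.d = d → P.L = L → K₀ ∣ P.M →
      ∀ {k : ℕ}, 1 ≤ k → k ≤ P.K → (∀ μ, 3 * half P k K₀ ≤ P.sitesPerDir 0 μ) → P.mesh k ≤ 1 →
      ∀ (S : Fin P.d → Finset ℕ) (sq₂ sq₁ : Finset (HiggsLattice.Site P k)),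
        underRegion k sq₂ = cellBox k K₀ S → sq₁ ⊆ sq₂ →
      ∀ (B : HiggsLattice.VecField P 0) {δB : ℝ}, 0 ≤ δB →
        (∀ z ∈ underRegion k sq₂, ∀ μ ν : Fin P.d, |B ⟨z.shift ν, μ⟩ - B ⟨z, μ⟩| ≤ δB) →
        (P.L : ℝ) ^ k * δB * |C.e| ≤ t →
      ∀ (A' : HiggsLattice.VecField P 0) {s : ℝ}, 0 ≤ s → (∀ b : HiggsLattice.PBond P 0, |A' b| ≤ s) →
      ∀ {δA : ℝ}, 0 ≤ δA →
        (∀ (z : HiggsLattice.Site P 0) (μ : Fin P.d), Inside (underRegion k sq₂) ⟨z, μ⟩ →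
          Inside (underRegion k sq₂) ⟨z.shift μ, μ⟩ → |A' ⟨z.shift μ, μ⟩ - A' ⟨z, μ⟩| ≤ δA) →
      ∀ (φ : HiggsLattice.ScalarField P k N) {t' : ℝ}, 0 ≤ t' → (∀ y ∈ sq₁, ‖φ y‖ ≤ t') →
      ∀ {W₀ W₁ : ℝ}, (∀ y, ‖bgScalar256 C msq a k sq₂ sq₁ (A' + B) φ y‖ ≤ W₀) → 0 ≤ W₁ →
        (∀ b : HiggsLattice.PBond P 0, Inside (underRegion k sq₂) b →
            ‖covDeriv C B (bgScalar256 C msq a k sq₂ sq₁ (A' + B) φ) b‖ ≤ W₁) →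
      ∀ b₀ : HiggsLattice.PBond P 0, Inside (underRegion k sq₂) b₀ →
        ‖covDeriv C (A' + B) (bgScalar256 C msq a k sq₂ sq₁ (A' + B) φ) b₀
            - covDeriv C B (bgScalar256 C msq a k sq₂ sq₁ B φ) b₀‖
          ≤ |C.e| * s * W₀
            + C₂ * P.mesh k *
                (B1.aSeq a P.L k * (P.mesh k)⁻¹ ^ 2 * (|C.e| * s * P.mesh 0 * (P.d * ((P.L : ℝ) ^ k - 1))) * t'
                  + |C.e| * s * (P.d * (2 * W₁ + |C.e| * s * W₀)) + (P.mesh 0)⁻¹ * (|C.e| * δA) * (P.d * W₀)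
                  + B1.aSeq a P.L k * (P.mesh k)⁻¹ ^ 2 *
                      ((2 * (|C.e| * s * P.mesh 0 * (P.d * ((P.L : ℝ) ^ k - 1)))
                        + (|C.e| * s * P.mesh 0 * (P.d * ((P.L : ℝ) ^ k - 1))) ^ 2) * W₀))
            + (P.mesh 0)⁻¹ * (|C.e| * s) * (P.d * W₀) *
                ∑ y ∈ (underRegion k sq₂).filter
                    (fun y => ∃ μ : Fin P.d, y.shift μ ∉ underRegion k sq₂ ∨ y.unshift μ ∉ underRegion k sq₂),
                  ∑ i : Ix N, ‖covDeriv C B (propagatorK C (underRegion k sq₂) B msq a k (cb P N 0 (y, i))) b₀‖ := by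
  obtain ⟨K₀min, hR⟩ := row_sums_box d L hd hL ha hmsq N C
  refine ⟨K₀min, fun K₀ hK₀ => ?_⟩
  obtain ⟨t, C₁, C₂, ht, hC₁, hC₂, hR⟩ := hR K₀ hK₀
  refine ⟨t, C₁, C₂, ht, hC₁, hC₂, ?_⟩
  intro P hPd hPL hK₀M k hk1 hkK h3 hmesh S sq₂ sq₁ hbox h12 B δB hδB hreg ht' A' s hs hA δA hδA hregA φ t' ht0 hφ W₀ W₁ hW₀
    hW₁nn hW₁ b₀ hb₀
  have hLr : (1 : ℝ) < P.L := by rw [hPL]; exact_mod_cast (by omega : 1 < L)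
  have hak : 0 ≤ B1.aSeq a P.L k := (B1.aSeq_pos ha hLr hk1).le
  set Ω := underRegion k sq₂ with hΩdef
  have hΩ : ∀ x x' : HiggsLattice.Site P 0, blockIter k x = blockIter k x' → (x ∈ Ω ↔ x' ∈ Ω) := by
    intro y y' h
    rw [hΩdef, mem_underRegion, mem_underRegion, h]
  -- the derivative column of `G_k(□, B)` at `b₀`
  have hreg' : ∀ z ∈ cellBox k K₀ S, ∀ μ ν : Fin P.d, |B ⟨z.shift ν, μ⟩ - B ⟨z, μ⟩| ≤ δB := by
    rw [← hbox]; exact hreg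
  have hb₀' : Inside (cellBox k K₀ S) b₀ := by rw [← hbox]; exact hb₀
  have hR₁ := (hR P hPd hPL hK₀M hk1 hkK h3 hmesh S B hδB hreg' ht').2 b₀ hb₀'
  rw [← hbox] at hR₁
  -- the identity and the three terms
  set w := bgScalar256 C msq a k sq₂ sq₁ (A' + B) φ with hw
  have hw0 : ∀ y, y ∉ Ω → w y = 0 := fun y hy => bgScalar256_eq_zero_of_not_mem hmsq hak h12 (A' + B) φ hy
  have hid := eq268_identity C sq₂ sq₁ A' B hmsq a hak φ
  have hT1 := norm_T1_deriv_le C hkK h12 A' B hs hA msq a φ ht0 hφ b₀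
  have hT2 := norm_T2_deriv_le C hkK hΩ A' B hs hA hδA hregA msq a w hw0 hW₀ hW₁nn hW₁ b₀
  have hκ : 0 ≤ B1.aSeq a P.L k * (P.mesh k ^ 2)⁻¹ := mul_nonneg hak (inv_nonneg.2 (sq_nonneg _))
  have hD : covDeriv C B w b₀
      = covDeriv C B (bgScalar256 C msq a k sq₂ sq₁ B φ) b₀
        + ((B1.aSeq a P.L k * (P.mesh k ^ 2)⁻¹) •
            covDeriv C B (propagatorK C Ω B msq a k (fTwoAdj C A' B k (cutTo sq₁ φ))) b₀
          + covDeriv C B (propagatorK C Ω B msq a k (opV C Ω A' B msq a k w)) b₀) := by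
    have h := congrArg (covDerivAt C B b₀) hid
    simp only [map_add, map_smul, covDerivAt_apply] at h
    rw [hw, h]
    abel
  have hdiff : covDeriv C (A' + B) w b₀ - covDeriv C B (bgScalar256 C msq a k sq₂ sq₁ B φ) b₀
      = mulM C A' B b₀ (w b₀.tgt)
        + ((B1.aSeq a P.L k * (P.mesh k ^ 2)⁻¹) •
            covDeriv C B (propagatorK C Ω B msq a k (fTwoAdj C A' B k (cutTo sq₁ φ))) b₀
          + covDeriv C B (propagatorK C Ω B msq a k (opV C Ω A' B msq a k w)) b₀) := by
    rw [covDeriv_add_split C A' B w b₀, hD]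
    abel
  rw [hdiff]
  have hes : 0 ≤ |C.e| * s := mul_nonneg (abs_nonneg _) hs
  have hW₀0 : 0 ≤ W₀ := (norm_nonneg _).trans (hW₀ b₀.src)
  have hm0 : 0 ≤ |C.e| * s * P.mesh 0 * (P.d * ((P.L : ℝ) ^ k - 1)) := by
    have hL1 : (1 : ℝ) ≤ (P.L : ℝ) ^ k := one_le_pow₀ hLr.le
    have := P.mesh_pos 0
    exact mul_nonneg (by positivity) (mul_nonneg (Nat.cast_nonneg _) (by linarith))
  have hεi : 0 ≤ (P.mesh 0)⁻¹ := inv_nonneg.2 (P.mesh_pos 0).le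
  have hM : ‖mulM C A' B b₀ (w b₀.tgt)‖ ≤ |C.e| * s * W₀ :=
    (norm_mulM_apply_le C A' B (hA b₀) _).trans (mul_le_mul_of_nonneg_left (hW₀ _) hes)
  have hcoef : 0 ≤ |C.e| * s * (P.d * (2 * W₁ + |C.e| * s * W₀)) + (P.mesh 0)⁻¹ * (|C.e| * δA) * (P.d * W₀)
      + |B1.aSeq a P.L k| * (P.mesh k)⁻¹ ^ 2 *
          ((2 * (|C.e| * s * P.mesh 0 * (P.d * ((P.L : ℝ) ^ k - 1)))
            + (|C.e| * s * P.mesh 0 * (P.d * ((P.L : ℝ) ^ k - 1))) ^ 2) * W₀) := by positivity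
  set sL := ∑ y ∈ Ω.filter (fun y => ∃ μ : Fin P.d, y.shift μ ∉ Ω ∨ y.unshift μ ∉ Ω),
      ∑ i : Ix N, ‖covDeriv C B (propagatorK C Ω B msq a k (cb P N 0 (y, i))) b₀‖ with hsL
  calc ‖mulM C A' B b₀ (w b₀.tgt)
          + ((B1.aSeq a P.L k * (P.mesh k ^ 2)⁻¹) •
              covDeriv C B (propagatorK C Ω B msq a k (fTwoAdj C A' B k (cutTo sq₁ φ))) b₀
            + covDeriv C B (propagatorK C Ω B msq a k (opV C Ω A' B msq a k w)) b₀)‖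
      ≤ ‖mulM C A' B b₀ (w b₀.tgt)‖
          + ((B1.aSeq a P.L k * (P.mesh k ^ 2)⁻¹) *
              ‖covDeriv C B (propagatorK C Ω B msq a k (fTwoAdj C A' B k (cutTo sq₁ φ))) b₀‖
            + ‖covDeriv C B (propagatorK C Ω B msq a k (opV C Ω A' B msq a k w)) b₀‖) := by
        refine (norm_add_le _ _).trans (add_le_add le_rfl ((norm_add_le _ _).trans (add_le_add (le_of_eq ?_) le_rfl)))
        rw [norm_smul, Real.norm_eq_abs, abs_of_nonneg hκ]
    _ ≤ |C.e| * s * W₀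
          + ((B1.aSeq a P.L k * (P.mesh k ^ 2)⁻¹) *
              (|C.e| * s * P.mesh 0 * (P.d * ((P.L : ℝ) ^ k - 1)) * t' *
                ∑ y ∈ Ω, ∑ i : Ix N, ‖covDeriv C B (propagatorK C Ω B msq a k (cb P N 0 (y, i))) b₀‖)
            + ((|C.e| * s * (P.d * (2 * W₁ + |C.e| * s * W₀)) + (P.mesh 0)⁻¹ * (|C.e| * δA) * (P.d * W₀)
                + |B1.aSeq a P.L k| * (P.mesh k)⁻¹ ^ 2 *
                    ((2 * (|C.e| * s * P.mesh 0 * (P.d * ((P.L : ℝ) ^ k - 1)))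
                      + (|C.e| * s * P.mesh 0 * (P.d * ((P.L : ℝ) ^ k - 1))) ^ 2) * W₀)) *
                  ∑ y ∈ Ω, ∑ i : Ix N, ‖covDeriv C B (propagatorK C Ω B msq a k (cb P N 0 (y, i))) b₀‖
              + (P.mesh 0)⁻¹ * (|C.e| * s) * (P.d * W₀) * sL)) :=
        add_le_add hM (add_le_add (mul_le_mul_of_nonneg_left hT1 hκ) hT2)
    _ ≤ |C.e| * s * W₀
          + ((B1.aSeq a P.L k * (P.mesh k ^ 2)⁻¹) *
              (|C.e| * s * P.mesh 0 * (P.d * ((P.L : ℝ) ^ k - 1)) * t' * (C₂ * P.mesh k))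
            + ((|C.e| * s * (P.d * (2 * W₁ + |C.e| * s * W₀)) + (P.mesh 0)⁻¹ * (|C.e| * δA) * (P.d * W₀)
                + |B1.aSeq a P.L k| * (P.mesh k)⁻¹ ^ 2 *
                    ((2 * (|C.e| * s * P.mesh 0 * (P.d * ((P.L : ℝ) ^ k - 1)))
                      + (|C.e| * s * P.mesh 0 * (P.d * ((P.L : ℝ) ^ k - 1))) ^ 2) * W₀)) * (C₂ * P.mesh k)
              + (P.mesh 0)⁻¹ * (|C.e| * s) * (P.d * W₀) * sL)) := by
        refine add_le_add le_rfl (add_le_add (mul_le_mul_of_nonneg_left (mul_le_mul_of_nonneg_left hR₁ (mul_nonneg hm0 ht0)) hκ)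
          (add_le_add (mul_le_mul_of_nonneg_left hR₁ hcoef) le_rfl))
    _ = |C.e| * s * W₀
          + C₂ * P.mesh k *
              (B1.aSeq a P.L k * (P.mesh k)⁻¹ ^ 2 * (|C.e| * s * P.mesh 0 * (P.d * ((P.L : ℝ) ^ k - 1))) * t'
                + |C.e| * s * (P.d * (2 * W₁ + |C.e| * s * W₀)) + (P.mesh 0)⁻¹ * (|C.e| * δA) * (P.d * W₀)
                + B1.aSeq a P.L k * (P.mesh k)⁻¹ ^ 2 *
                    ((2 * (|C.e| * s * P.mesh 0 * (P.d * ((P.L : ℝ) ^ k - 1)))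
                      + (|C.e| * s * P.mesh 0 * (P.d * ((P.L : ℝ) ^ k - 1))) ^ 2) * W₀))
          + (P.mesh 0)⁻¹ * (|C.e| * s) * (P.d * W₀) * sL := by
        rw [abs_of_nonneg hak, inv_pow]
        ring

end Eq268Deriv

end Literature.MathematicalPhysics.QuantumFieldTheory.Balaban1983to89.B2Eq268DerivHiggsRegion

end
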